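import Summits.CriticalPhenomena.Ising3DConformalLimit.Theorems.IsingEuclidUpgradeR4NonGaussianDefs
import Summits.CriticalPhenomena.Ising3DConformalLimit.Theorems.IsingEuclidUpgradeR4NonGaussianMomentRatioBubble
import Summits.CriticalPhenomena.Ising3DConformalLimit.Theorems.IsingEuclidUpgradeR4NonGaussianMomentRatioWindow
import HarnessLib

/-!
# Crux `IsingEuclidUpgradeR4NonGaussian` (stmt-CriticalPhenomena-0636), line `free-covariance-delta-dichotomy`:
# registered stub `stub_momentRatioLowerBound` — the moment-ratio lower bound (ADC21 Lemma 4.4,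
# analytic half) in `d = 3` below `Δ = 3/4`

For a non-degenerate pointwise scaling limit `S` of the critical Ising₃ correlators (renormalisation
`ρ > 0` on `(0,1]`), scale covariant on non-coincident configurations with exponent `Δ < 3/4`, and
a non-coincident quadruple `x`, there are `c > 0` and counting regions `A(δ) ⊂ ℤ³` such that for all
small `δ` and all large `L` the box moments of ADC21 Lemma 4.4 at `x̃ᵢ = [xᵢ/δ]` satisfy
`M₁²/M₂ ≥ c` (`stub_momentRatioLowerBound`, registered signature of the checked skeleton
`Cruxes/IsingEuclidUpgradeR4NonGaussian/Lines/free-covariance-delta-dichotomy.lean`).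

Proof. `A(δ) = Λ_n + [z/δ]`, `n = ⌊1/δ⌋ - 1`, `z = (∑ᵢ‖xᵢ‖ + 5)e₀`, `|A| = (2n+1)³`.
* §A: `Λ_L ↑ ℤ³` termwise (`criticalCorr_wellDefined_holds`, free b.c.) and positivity of the
  critical two-point function (`criticalTwoPoint_bounds_holds`): only the infinite-volume moments
  `M₁, M₂` at mesh `δ` matter, and `M₂ > 0`.
* the window `ℓ ≤ ρ(δ)²⟨σσ⟩ ≤ U` for all pair correlators between sources and region sites, between
  the two source pairs, and at the top axis scale (`stub_momentRatioWindow`, file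
  `…MomentRatioWindow`), whence `M₁ ≥ |A| (ℓ²/(Uρ²))²` and every term of `M₂` is
  `≤ (2U²/(ℓρ²))² ⟨σ_vσ_w⟩²`;
* the dyadic bubble bound (`stub_momentRatioBubble`, file `…MomentRatioBubble`, the only input using
  `4Δ < 3`): `∑_{w ∈ A} ⟨σ_vσ_w⟩² ≤ ∑_{‖y‖ ≤ 2n} ⟨σ₀σ_y⟩² ≤ K 8^J ⟨σ₀σ_{2^J e₀}⟩² ≤ K n³ (U/ρ²)²`
  (`2^J ≤ n < 2^{J+1}`), so `M₂ ≤ 4KU⁶|A|n³/(ℓ²ρ⁸)` and `M₁²/M₂ ≥ ℓ¹⁰|A|/(4KU¹⁰n³) ≥ ℓ¹⁰/(4KU¹⁰)`.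

References: M. Aizenman, H. Duminil-Copin, Ann. Math. 194 (2021) = arXiv:1912.07973, §4.2 Lemma 4.4
and App. A Prop. A.3; A. Messager, S. Miracle-Solé, J. Stat. Phys. 17 (1977).
-/

noncomputable section

open Filter Topology Set Function MeasureTheory Finset
open Literature.Probability.LatticeModels Literature.Probability.Percolation
open scoped symmDiff

namespace Summit.CriticalPhenomena.Ising3DConformalLimit.Cruxes.IsingEuclidUpgradeR4NonGaussian.FreeCovarianceDeltaDichotomy

/-! ## A. Infinite-volume dictionary -/

/-- `0 < ⟨σ_aσ_b⟩_{β_c}` on `ℤ³` (Simon–Lieb lower bound off the diagonal, `= 1` on it). [folklore] -/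
private theorem criticalCorr_pair_pos (a b : Site 3) : 0 < criticalCorr 3 2 ![a, b] := by
  rw [criticalCorr_two_pair]
  by_cases hu : b - a = 0
  · rw [hu, criticalTwoPoint_zero']; exact one_pos
  · obtain ⟨c, C, hc, h⟩ := criticalTwoPoint_bounds_holds (d := 3) le_rfl
    have hn : 0 < ‖b - a‖ := norm_pos_iff.2 hu
    exact lt_of_lt_of_le (mul_pos hc (Real.rpow_pos_of_pos hn _)) (h _ hu).1

/-- The free box two-point function converges to the critical pair correlator. [folklore] -/
private theorem tendsto_boxG (u v : Site 3) :
    Tendsto (fun L => boxG L u v) atTop (𝓝 (criticalCorr 3 2 ![u, v])) := by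
  have hmem : (BoundaryCondition.free : BoundaryCondition (Site 3)) ∈
      ({.free, .plus, .minus} : Set (BoundaryCondition (Site 3))) := by simp
  have h := criticalCorr_wellDefined_holds (d := 3) le_rfl 2 ![u, v] .free hmem
  refine Tendsto.congr (fun L => ?_) h
  simp only [boxG, isingTwoPoint, spinMonomial_two]

/-- `L → ∞` limit of the three-point ratio. [folklore] -/
private theorem tendsto_threePointRatio (a b v : Site 3) :
    Tendsto (fun L => threePointRatio L a b v) atTop
      (𝓝 (criticalCorr 3 2 ![a, v] * criticalCorr 3 2 ![v, b] / criticalCorr 3 2 ![a, b])) :=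
  ((tendsto_boxG a v).mul (tendsto_boxG v b)).div (tendsto_boxG a b) (criticalCorr_pair_pos a b).ne'

/-- `L → ∞` limit of the first moment (`G` = the critical pair correlator). [folklore] -/
private theorem tendsto_boxMoment₁ {G : Site 3 → Site 3 → ℝ}
    (hG : ∀ u v, G u v = criticalCorr 3 2 ![u, v]) (a b c e : Site 3) (A : Finset (Site 3)) :
    Tendsto (fun L => boxMoment₁ L a b c e A) atTop
      (𝓝 (∑ v ∈ A, (G a v * G v b / G a b) * (G c v * G v e / G c e))) := by
  obtain rfl : G = fun u v => criticalCorr 3 2 ![u, v] := funext fun u => funext fun v => hG u v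
  exact tendsto_finsetSum A fun v _ =>
    (tendsto_threePointRatio a b v).mul (tendsto_threePointRatio c e v)

/-- `L → ∞` limit of the two-step kernel divided by the pair correlator. [folklore] -/
private theorem tendsto_twoStep_div (a b v w : Site 3) :
    Tendsto (fun L => twoStep L a b v w / boxG L a b) atTop
      (𝓝 ((criticalCorr 3 2 ![a, v] * criticalCorr 3 2 ![v, w] * criticalCorr 3 2 ![w, b] +
        criticalCorr 3 2 ![a, w] * criticalCorr 3 2 ![w, v] * criticalCorr 3 2 ![v, b]) /
        criticalCorr 3 2 ![a, b])) :=
  ((((tendsto_boxG a v).mul (tendsto_boxG v w)).mul (tendsto_boxG w b)).add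
    (((tendsto_boxG a w).mul (tendsto_boxG w v)).mul (tendsto_boxG v b))).div (tendsto_boxG a b)
    (criticalCorr_pair_pos a b).ne'

/-- `L → ∞` limit of the second moment (`G` = the critical pair correlator). [folklore] -/
private theorem tendsto_boxMoment₂ {G : Site 3 → Site 3 → ℝ}
    (hG : ∀ u v, G u v = criticalCorr 3 2 ![u, v]) (a b c e : Site 3) (A : Finset (Site 3)) :
    Tendsto (fun L => boxMoment₂ L a b c e A) atTop
      (𝓝 (∑ v ∈ A, ∑ w ∈ A,
        ((G a v * G v w * G w b + G a w * G w v * G v b) / G a b) *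
        ((G c v * G v w * G w e + G c w * G w v * G v e) / G c e))) := by
  obtain rfl : G = fun u v => criticalCorr 3 2 ![u, v] := funext fun u => funext fun v => hG u v
  exact tendsto_finsetSum A fun v _ => tendsto_finsetSum A fun w _ =>
    (tendsto_twoStep_div a b v w).mul (tendsto_twoStep_div c e v w)

/-- Scale covariance at `(0,e₀) ↦ (0,2e₀)` on non-coincident configurations:
`S₂(0,2e₀) = 2^{-2Δ} S₂(0,e₀)`. [folklore] -/
private theorem S_two_unitVec_eq_of_covOn {Δ : ℝ} {S : CorrFamily 3} (hcov : ScaleCovariantOn Δ S) :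
    S 2 ![0, EuclideanSpace.single (0 : Fin 3) ((2 : ℕ) : ℝ)] =
      (2 : ℝ) ^ (-(2 : ℝ) * Δ) * S 2 ![0, EuclideanSpace.single (0 : Fin 3) ((1 : ℕ) : ℝ)] := by
  have h := hcov 2 2 (by norm_num) ![0, EuclideanSpace.single (0 : Fin 3) ((1 : ℕ) : ℝ)]
    (zero_unitVec_mem_nonCoincident (by norm_num))
  have hcfg : (fun i => (2 : ℝ) • (![0, EuclideanSpace.single (0 : Fin 3) ((1 : ℕ) : ℝ)] :
      Fin 2 → EuclideanSpace ℝ (Fin 3)) i) = ![0, EuclideanSpace.single (0 : Fin 3) ((2 : ℕ) : ℝ)] := by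
    funext i
    fin_cases i
    · simp
    · simp only [Nat.cast_ofNat, Fin.mk_one, Matrix.cons_val_one, Matrix.cons_val_fin_one,
        Nat.cast_one]
      ext j
      simp
  rw [hcfg] at h
  rw [h]
  norm_num

/-! ## B. Elementary real arithmetic of the moment bounds -/

/-- Lower bound for a three-point ratio `pq/s` from `ℓ ≤ rp`, `ℓ ≤ rq`, `rs ≤ U`. [folklore] -/
private theorem ratio_lower {r ℓ U p q s : ℝ} (hr : 0 < r) (hℓ : 0 < ℓ) (hp : ℓ ≤ r * p)
    (hq : ℓ ≤ r * q) (hs : 0 < s) (hsU : r * s ≤ U) : ℓ ^ 2 / (U * r) ≤ p * q / s := by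
  have hU : 0 < U := lt_of_lt_of_le (mul_pos hr hs) hsU
  rw [div_le_div_iff₀ (mul_pos hU hr) hs]
  have h1 : ℓ * ℓ ≤ (r * p) * (r * q) := mul_le_mul hp hq hℓ.le ((hℓ.le).trans hp)
  nlinarith [mul_le_mul_of_nonneg_left hsU (mul_nonneg (mul_nonneg hr.le hs.le) hℓ.le)]

/-- Upper bound for a two-step term `(p g q + p' g q')/s` from `rp, rq, rp', rq' ≤ U`, `ℓ ≤ rs`.
[folklore] -/
private theorem twoStep_upper {r ℓ U p q p' q' g s : ℝ} (hr : 0 < r) (hℓ : 0 < ℓ) (hp0 : 0 ≤ p)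
    (hq0 : 0 ≤ q) (hp0' : 0 ≤ p') (hq0' : 0 ≤ q') (hg : 0 ≤ g) (hp : r * p ≤ U) (hq : r * q ≤ U)
    (hp' : r * p' ≤ U) (hq' : r * q' ≤ U) (hs : ℓ ≤ r * s) :
    (p * g * q + p' * g * q') / s ≤ 2 * U ^ 2 / (ℓ * r) * g := by
  have hs0 : 0 < s := by
    by_contra h
    push Not at h
    have : r * s ≤ 0 := mul_nonpos_of_nonneg_of_nonpos hr.le h
    linarith
  have hU : 0 ≤ U := le_trans (mul_nonneg hr.le hp0) hp
  rw [div_mul_eq_mul_div, div_le_div_iff₀ hs0 (mul_pos hℓ hr)]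
  have h1 : (r * p) * (r * q) ≤ U * U := mul_le_mul hp hq (mul_nonneg hr.le hq0) hU
  have h2 : (r * p') * (r * q') ≤ U * U := mul_le_mul hp' hq' (mul_nonneg hr.le hq0') hU
  have h3 : ℓ * (p * q) ≤ r * s * (p * q) := mul_le_mul_of_nonneg_right hs (mul_nonneg hp0 hq0)
  have h4 : ℓ * (p' * q') ≤ r * s * (p' * q') := mul_le_mul_of_nonneg_right hs (mul_nonneg hp0' hq0')
  have h5 : ℓ * r * (p * q) ≤ U * U * s := by
    calc ℓ * r * (p * q) = r * (ℓ * (p * q)) := by ring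
      _ ≤ r * (r * s * (p * q)) := mul_le_mul_of_nonneg_left h3 hr.le
      _ = s * ((r * p) * (r * q)) := by ring
      _ ≤ s * (U * U) := mul_le_mul_of_nonneg_left h1 hs0.le
      _ = U * U * s := by ring
  have h6 : ℓ * r * (p' * q') ≤ U * U * s := by
    calc ℓ * r * (p' * q') = r * (ℓ * (p' * q')) := by ring
      _ ≤ r * (r * s * (p' * q')) := mul_le_mul_of_nonneg_left h4 hr.le
      _ = s * ((r * p') * (r * q')) := by ring
      _ ≤ s * (U * U) := mul_le_mul_of_nonneg_left h2 hs0.le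
      _ = U * U * s := by ring
  calc (p * g * q + p' * g * q') * (ℓ * r)
      = g * (ℓ * r * (p * q)) + g * (ℓ * r * (p' * q')) := by ring
    _ ≤ g * (U * U * s) + g * (U * U * s) :=
      add_le_add (mul_le_mul_of_nonneg_left h5 hg) (mul_le_mul_of_nonneg_left h6 hg)
    _ = 2 * U ^ 2 * g * s := by ring

/-! ## C. The moment-ratio lower bound -/

/-- **Registered stub `stub_momentRatioLowerBound`** (FAT STEP, analytic half of ADC21 Lemma 4.4 in
`d = 3`): below `Δ = 3/4` the box moment ratio `M₁²/M₂` at the mesh-`δ` lattice points of a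
non-coincident quadruple `x` stays `≥ c > 0` for all small `δ` and all large `L`, for the counting
regions `A(δ) = Λ_{⌊1/δ⌋-1} + [z/δ]`, `z = (∑ᵢ‖xᵢ‖ + 5)e₀` (window `stub_momentRatioWindow`, dyadic
bubble bound `stub_momentRatioBubble`, `Λ_L ↑ ℤ³` termwise). [cite: AizenmanDuminilCopinAnnals2021, §4.2, Lemma 4.4] -/
theorem stub_momentRatioLowerBound :
    ∀ (ρ : ℝ → ℝ) (S : CorrFamily 3) (Δ : ℝ), (∀ δ ∈ Set.Ioc (0:ℝ) 1, 0 < ρ δ) →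
      HasPointwiseScalingLimit (criticalCorr 3) ρ S → IsNondegenerateTwoPoint S →
      ScaleCovariantOn Δ S → Δ < 3 / 4 →
      ∀ x ∈ NonCoincident 3 4, ∃ c : ℝ, 0 < c ∧ ∃ A : ℝ → Finset (Site 3),
        ∀ᶠ δ in 𝓝[>] (0:ℝ), ∀ᶠ L : ℕ in atTop,
          c ≤ boxMoment₁ L (lat δ x 0) (lat δ x 1) (lat δ x 2) (lat δ x 3) (A δ) ^ 2 /
              boxMoment₂ L (lat δ x 0) (lat δ x 1) (lat δ x 2) (lat δ x 3) (A δ) := by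
  classical
  intro ρ S Δ hρ hlim hnd hcov hΔ x hx
  set G : Site 3 → Site 3 → ℝ := fun u v => criticalCorr 3 2 ![u, v] with hGdef
  have hG : ∀ u v, G u v = criticalCorr 3 2 ![u, v] := fun u v => rfl
  have hGp : ∀ u v : Site 3, 0 < G u v := fun u v => criticalCorr_pair_pos u v
  have hG0 : ∀ u v : Site 3, 0 ≤ G u v := fun u v => (hGp u v).le
  /- ① the window and the bubble constant -/
  obtain ⟨ℓ, U, hℓpos, hℓU, hwin⟩ := stub_momentRatioWindow ρ S hlim hnd x hx
  have hUpos : 0 < U := hℓpos.trans_le hℓU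
  obtain ⟨K, hK, i₀, hbub⟩ :=
    stub_momentRatioBubble ρ S Δ hlim hnd (S_two_unitVec_eq_of_covOn hcov) hΔ
  set z : EuclideanSpace ℝ (Fin 3) :=
    ((∑ j, ‖x j‖) + 5) • EuclideanSpace.single (0 : Fin 3) (1:ℝ) with hz
  /- ② the constant and the counting regions -/
  set κ : ℝ := ℓ ^ 10 / (8 * K * U ^ 10) with hκ
  have hκpos : 0 < κ := by rw [hκ]; positivity
  refine ⟨κ, hκpos, fun δ => (box 3 (⌊δ⁻¹⌋₊ - 1)).image (fun u => u + latticeApprox δ z), ?_⟩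
  set δ₁ : ℝ := min (1/4) ((2:ℝ) ^ i₀ + 2)⁻¹ with hδ₁
  have hδ₁pos : 0 < δ₁ := lt_min (by norm_num) (by positivity)
  have E4 : ∀ᶠ δ in 𝓝[>] (0:ℝ), δ ∈ Set.Ioo 0 δ₁ := Ioo_mem_nhdsGT hδ₁pos
  have E5 : ∀ᶠ δ in 𝓝[>] (0:ℝ), δ ∈ Set.Ioc (0:ℝ) 1 := Ioc_mem_nhdsGT one_pos
  filter_upwards [hwin, E4, E5] with δ hw h4 h5
  obtain ⟨hGab, hGce, hGreg, hGtop⟩ := hw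
  /- ③ the deterministic estimate at mesh `δ` -/
  obtain ⟨hδpos, hδlt⟩ := h4
  have hδ4 : δ ≤ 1/4 := hδlt.le.trans (min_le_left _ _)
  have hδi : δ < ((2:ℝ) ^ i₀ + 2)⁻¹ := hδlt.trans_le (min_le_right _ _)
  set r : ℝ := ρ δ ^ 2 with hr
  have hrpos : 0 < r := pow_pos (hρ δ h5) 2
  -- the integers `N = ⌊1/δ⌋`, `n = N - 1`, and the top dyadic scale `2^J ≤ n < 2^{J+1}`
  set N : ℕ := ⌊δ⁻¹⌋₊ with hN
  set n : ℕ := N - 1 with hn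
  have hinv1 : (1:ℝ) ≤ δ⁻¹ := (one_le_inv₀ hδpos).2 h5.2
  have hN1 : 1 ≤ N := Nat.le_floor (by exact_mod_cast hinv1)
  have hnN : n + 1 = N := by omega
  have hNle : (N:ℝ) ≤ δ⁻¹ := Nat.floor_le (by positivity)
  have hNgt : δ⁻¹ < (N:ℝ) + 1 := Nat.lt_floor_add_one _
  have hnR : (n:ℝ) + 1 = N := by exact_mod_cast hnN
  have hn1δ : ((n:ℝ) + 1) * δ ≤ 1 := by
    rw [hnR]
    calc (N:ℝ) * δ ≤ δ⁻¹ * δ := mul_le_mul_of_nonneg_right hNle hδpos.le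
      _ = 1 := inv_mul_cancel₀ hδpos.ne'
  have hn34 : 3/4 ≤ ((n:ℝ) + 1) * δ := by
    have e : (δ⁻¹ - 1) * δ = 1 - δ := by rw [sub_mul, inv_mul_cancel₀ hδpos.ne', one_mul]
    have hlt : (δ⁻¹ - 1) * δ < ((n:ℝ) + 1) * δ :=
      mul_lt_mul_of_pos_right (by linarith only [hNgt, hnR]) hδpos
    linarith only [e, hlt, hδ4]
  have hi₀n : 2 ^ i₀ ≤ n := by
    have h := (lt_inv_comm₀ hδpos (by positivity)).1 hδi
    have : (2:ℝ) ^ i₀ < n := by linarith only [h, hNgt, hnR]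
    exact_mod_cast this.le
  have hn0 : n ≠ 0 := by have := Nat.one_le_two_pow (n := i₀); omega
  set J : ℕ := Nat.log 2 n with hJ
  have hJn : 2 ^ J ≤ n := Nat.pow_log_le_self 2 hn0
  have hnJ : n < 2 ^ (J + 1) := Nat.lt_pow_succ_log_self one_lt_two n
  have hi₀J : i₀ ≤ J := Nat.le_log_of_pow_le one_lt_two hi₀n
  -- the translate, the region, the sources
  set p : Site 3 := latticeApprox δ z with hp
  set A : Finset (Site 3) := (box 3 n).image (fun u => u + p) with hA
  have hcardA : #A = (2 * n + 1) ^ 3 := by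
    rw [hA, Finset.card_image_of_injective _ (add_left_injective p), card_box]
  have hAne : A.Nonempty := by
    rw [hA]
    exact Finset.image_nonempty.2 ⟨0, by simp [mem_box]⟩
  set a : Site 3 := lat δ x 0 with ha
  set b : Site 3 := lat δ x 1 with hb
  set c : Site 3 := lat δ x 2 with hc
  set e : Site 3 := lat δ x 3 with he
  -- the window
  have hGab' : ℓ ≤ r * G a b ∧ r * G a b ≤ U := hGab
  have hGce' : ℓ ≤ r * G c e ∧ r * G c e ≤ U := hGce
  have hGxv : ∀ i : Fin 4, ∀ v ∈ A, ℓ ≤ r * G (lat δ x i) v ∧ r * G (lat δ x i) v ≤ U := by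
    intro i v hv
    obtain ⟨u, hu, rfl⟩ := Finset.mem_image.1 hv
    exact hGreg n hn1δ i u hu
  have hGvx : ∀ i : Fin 4, ∀ v ∈ A, ℓ ≤ r * G v (lat δ x i) ∧ r * G v (lat δ x i) ≤ U := by
    intro i v hv
    have hsymm : G v (lat δ x i) = G (lat δ x i) v := criticalCorr_two_pair_comm _ _
    rw [hsymm]; exact hGxv i v hv
  have htop : r * criticalTwoPoint 3 (Pi.single (0 : Fin 3) ((2:ℤ) ^ J)) ≤ U := by
    have hJnR : (2:ℝ) ^ J ≤ n := by exact_mod_cast hJn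
    have hnJR : (n:ℝ) + 1 ≤ 2 * 2 ^ J := by
      have : n + 1 ≤ 2 * 2 ^ J := by rw [pow_succ] at hnJ; omega
      exact_mod_cast this
    have ht1 : δ * 2 ^ J ≤ 1 := by
      have h2 : δ * 2 ^ J ≤ δ * n := mul_le_mul_of_nonneg_left hJnR hδpos.le
      linarith only [h2, hn1δ, hδpos]
    have ht4 : 1/4 ≤ δ * 2 ^ J := by
      have h2 : ((n:ℝ) + 1) * δ ≤ 2 * 2 ^ J * δ := mul_le_mul_of_nonneg_right hnJR hδpos.le
      linarith only [h2, hn34]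
    have h := hGtop (2 ^ J) (by push_cast; exact ht4) (by push_cast; exact ht1)
    push_cast at h
    exact h
  -- the bubble at scale `2n`
  have hbubble : ∑ y ∈ box 3 (2 * n), criticalTwoPoint 3 y ^ 2 ≤ K * (n:ℝ) ^ 3 * (U / r) ^ 2 := by
    have hpow : 2 ^ (J + 2) = 2 * 2 ^ (J + 1) := by ring
    have hsub : box 3 (2 * n) ⊆ box 3 (2 ^ (J + 2)) := box_mono 3 (by omega)
    have h3' : (8:ℝ) ^ J ≤ (n:ℝ) ^ 3 := by
      have hh : (2 ^ J) ^ 3 ≤ n ^ 3 := Nat.pow_le_pow_left hJn 3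
      have e8 : (8:ℝ) ^ J = (((2 ^ J) ^ 3 : ℕ) : ℝ) := by
        push_cast
        rw [← pow_mul, mul_comm, pow_mul]
        norm_num
      rw [e8]
      exact_mod_cast hh
    have h4' : criticalTwoPoint 3 (Pi.single (0 : Fin 3) ((2:ℤ) ^ J)) ^ 2 ≤ (U / r) ^ 2 := by
      refine pow_le_pow_left₀ (criticalTwoPoint_nonneg' _) ?_ 2
      rw [le_div_iff₀ hrpos, mul_comm]
      exact htop
    calc ∑ y ∈ box 3 (2 * n), criticalTwoPoint 3 y ^ 2
        ≤ ∑ y ∈ box 3 (2 ^ (J + 2)), criticalTwoPoint 3 y ^ 2 :=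
          Finset.sum_le_sum_of_subset_of_nonneg hsub fun y _ _ => sq_nonneg _
      _ ≤ K * 8 ^ J * criticalTwoPoint 3 (Pi.single (0 : Fin 3) ((2:ℤ) ^ J)) ^ 2 := hbub J hi₀J
      _ ≤ K * (n:ℝ) ^ 3 * (U / r) ^ 2 := by gcongr
  -- the inner sums of `M₂` are bubbles at scale `2n`
  have hinner : ∀ v ∈ A, ∑ w ∈ A, criticalTwoPoint 3 (w - v) ^ 2 ≤
      ∑ y ∈ box 3 (2 * n), criticalTwoPoint 3 y ^ 2 := by
    intro v hv
    obtain ⟨u, hu, huv⟩ := Finset.mem_image.1 hv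
    have hv' : v = u + p := huv.symm
    rw [hA, Finset.sum_image fun _ _ _ _ h => add_left_injective p h, hv']
    simp_rw [add_sub_add_right_eq_sub]
    calc ∑ u' ∈ box 3 n, criticalTwoPoint 3 (u' - u) ^ 2
        = ∑ y ∈ (box 3 n).image (fun u' => u' - u), criticalTwoPoint 3 y ^ 2 := by
          rw [Finset.sum_image fun _ _ _ _ h => sub_left_injective h]
      _ ≤ ∑ y ∈ box 3 (2 * n), criticalTwoPoint 3 y ^ 2 := by
          refine Finset.sum_le_sum_of_subset_of_nonneg ?_ fun y _ _ => sq_nonneg _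
          refine Finset.image_subset_iff.2 fun u' hu' => ?_
          rw [mem_box] at hu hu' ⊢
          intro j
          obtain ⟨hu1, hu2⟩ := hu j
          obtain ⟨hu1', hu2'⟩ := hu' j
          simp only [Pi.sub_apply]
          push_cast
          omega
  -- the moments in infinite volume
  set M₁ : ℝ := ∑ v ∈ A, (G a v * G v b / G a b) * (G c v * G v e / G c e) with hM₁
  set M₂ : ℝ := ∑ v ∈ A, ∑ w ∈ A,
    ((G a v * G v w * G w b + G a w * G w v * G v b) / G a b) *
    ((G c v * G v w * G w e + G c w * G w v * G v e) / G c e) with hM₂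
  -- lower bound on `M₁`
  set τ : ℝ := ℓ ^ 2 / (U * r) with hτ
  have hτ0 : 0 ≤ τ := by rw [hτ]; positivity
  have hM₁lo : (#A : ℝ) * τ ^ 2 ≤ M₁ := by
    rw [hM₁, ← nsmul_eq_mul, ← Finset.sum_const]
    refine Finset.sum_le_sum fun v hv => ?_
    rw [pow_two]
    refine mul_le_mul ?_ ?_ hτ0 ?_
    · exact ratio_lower hrpos hℓpos (hGxv 0 v hv).1 (hGvx 1 v hv).1 (hGp _ _) hGab'.2
    · exact ratio_lower hrpos hℓpos (hGxv 2 v hv).1 (hGvx 3 v hv).1 (hGp _ _) hGce'.2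
    · exact div_nonneg (mul_nonneg (hG0 _ _) (hG0 _ _)) (hG0 _ _)
  -- upper bound on `M₂`
  set σ : ℝ := 2 * U ^ 2 / (ℓ * r) with hσ
  have hσ0 : 0 ≤ σ := by rw [hσ]; positivity
  have hterm : ∀ v ∈ A, ∀ w ∈ A,
      ((G a v * G v w * G w b + G a w * G w v * G v b) / G a b) *
        ((G c v * G v w * G w e + G c w * G w v * G v e) / G c e)
        ≤ σ ^ 2 * criticalTwoPoint 3 (w - v) ^ 2 := by
    intro v hv w hw
    have hvw : G v w = criticalTwoPoint 3 (w - v) := criticalCorr_two_pair v w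
    have hwv : G w v = criticalTwoPoint 3 (w - v) :=
      (criticalCorr_two_pair_comm w v).trans (criticalCorr_two_pair v w)
    rw [hvw, hwv]
    have hg0 : 0 ≤ criticalTwoPoint 3 (w - v) := criticalTwoPoint_nonneg' _
    have hab' := twoStep_upper hrpos hℓpos (hG0 _ _) (hG0 _ _) (hG0 _ _) (hG0 _ _) hg0
      (hGxv 0 v hv).2 (hGvx 1 w hw).2 (hGxv 0 w hw).2 (hGvx 1 v hv).2 hGab'.1
    have hce' := twoStep_upper hrpos hℓpos (hG0 _ _) (hG0 _ _) (hG0 _ _) (hG0 _ _) hg0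
      (hGxv 2 v hv).2 (hGvx 3 w hw).2 (hGxv 2 w hw).2 (hGvx 3 v hv).2 hGce'.1
    calc _ ≤ (σ * criticalTwoPoint 3 (w - v)) * (σ * criticalTwoPoint 3 (w - v)) :=
          mul_le_mul hab' hce' (div_nonneg (add_nonneg (mul_nonneg (mul_nonneg (hG0 _ _) hg0) (hG0 _ _))
            (mul_nonneg (mul_nonneg (hG0 _ _) hg0) (hG0 _ _))) (hG0 _ _)) (mul_nonneg hσ0 hg0)
      _ = σ ^ 2 * criticalTwoPoint 3 (w - v) ^ 2 := by ring
  have hM₂hi : M₂ ≤ σ ^ 2 * ((#A : ℝ) * (K * (n:ℝ) ^ 3 * (U / r) ^ 2)) := by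
    calc M₂ ≤ ∑ v ∈ A, ∑ w ∈ A, σ ^ 2 * criticalTwoPoint 3 (w - v) ^ 2 :=
          Finset.sum_le_sum fun v hv => Finset.sum_le_sum fun w hw => hterm v hv w hw
      _ = σ ^ 2 * ∑ v ∈ A, ∑ w ∈ A, criticalTwoPoint 3 (w - v) ^ 2 := by
          rw [Finset.mul_sum]
          refine Finset.sum_congr rfl fun v _ => ?_
          rw [Finset.mul_sum]
      _ ≤ σ ^ 2 * ∑ _v ∈ A, K * (n:ℝ) ^ 3 * (U / r) ^ 2 := by
          refine mul_le_mul_of_nonneg_left (Finset.sum_le_sum fun v hv => ?_) (sq_nonneg _)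
          exact (hinner v hv).trans hbubble
      _ = σ ^ 2 * ((#A : ℝ) * (K * (n:ℝ) ^ 3 * (U / r) ^ 2)) := by
          rw [Finset.sum_const, nsmul_eq_mul]
  -- positivity of `M₂`
  have hM₂pos : 0 < M₂ := by
    refine Finset.sum_pos (fun v _ => Finset.sum_pos (fun w _ => ?_) hAne) hAne
    refine mul_pos (div_pos (add_pos ?_ ?_) (hGp _ _)) (div_pos (add_pos ?_ ?_) (hGp _ _)) <;>
      exact mul_pos (mul_pos (hGp _ _) (hGp _ _)) (hGp _ _)
  -- the ratio
  have hAcard : (n:ℝ) ^ 3 ≤ #A := by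
    rw [hcardA]; push_cast
    exact pow_le_pow_left₀ (by positivity) (by linarith only [(Nat.cast_nonneg n : (0:ℝ) ≤ n)]) 3
  have hK0 : K ≠ 0 := hK.ne'
  have hU0 : U ≠ 0 := hUpos.ne'
  have hℓ0 : ℓ ≠ 0 := hℓpos.ne'
  have hr0 : r ≠ 0 := hrpos.ne'
  have hkey : 2 * κ * M₂ ≤ M₁ ^ 2 := by
    calc 2 * κ * M₂ ≤ 2 * κ * (σ ^ 2 * ((#A : ℝ) * (K * (n:ℝ) ^ 3 * (U / r) ^ 2))) :=
          mul_le_mul_of_nonneg_left hM₂hi (by positivity)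
      _ = (ℓ ^ 8 / (U ^ 4 * r ^ 4)) * #A * (n:ℝ) ^ 3 := by
          rw [hκ, hσ]
          field_simp
          ring
      _ ≤ (ℓ ^ 8 / (U ^ 4 * r ^ 4)) * #A * #A :=
          mul_le_mul_of_nonneg_left hAcard (by positivity)
      _ = ((#A : ℝ) * τ ^ 2) ^ 2 := by
          rw [hτ]
          field_simp
      _ ≤ M₁ ^ 2 := pow_le_pow_left₀ (by positivity) hM₁lo 2
  have hratio : κ < M₁ ^ 2 / M₂ := by
    rw [lt_div_iff₀ hM₂pos]
    linarith only [hkey, mul_pos hκpos hM₂pos]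
  /- ④ `Λ_L ↑ ℤ³` -/
  have hT := ((tendsto_boxMoment₁ hG a b c e A).pow 2).div (tendsto_boxMoment₂ hG a b c e A) hM₂pos.ne'
  exact (hT.eventually_const_lt hratio).mono fun L hL => hL.le

end Summit.CriticalPhenomena.Ising3DConformalLimit.Cruxes.IsingEuclidUpgradeR4NonGaussian.FreeCovarianceDeltaDichotomy

end
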